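import Summits.NavierStokesRegularity.NavierStokesRegularity.Theorems.CertifiedBlowupCertifiedBlowupVorticityRateBlowupDepletionFloorLate
import Summits.NavierStokesRegularity.NavierStokesRegularity.Theorems.CertifiedBlowupCertifiedBlowupAxisymBlowupTimeShift
import HarnessLib

/-!
# Certificate class `CertifiedBlowupVorticityRateBlowup` (stmt-NavierStokesRegularity-8639): THE FLOOR CHAIN NEEDS THE
# SLAB GRÖNWALL ONLY NEAR `T` — `(S_κ)` on the slabs of `[t₀, T)` already forces `1/(2κ) ≤ C`

Theorems file landed `--supports stmt-NavierStokesRegularity-8639` (cell `ns-blowup`, GROUP B zone Z1; companion of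
`…AxisymBlowupTimeShift`, wake item (w1′) of `WAKE-ns-blowup-profile-eng-1-20260827T2156Z`: the EVENTUAL-hypothesis
forms of the floor chain (K86)). Deposits 9–10 (`…SlabFloor`, `…SlabExponent`) carry the slab Grönwall `(S_κ)` —
`∫|ω(t₂)|² ≤ ∫|ω(t₁)|²·exp(κΩ(t₂ − t₁))` whenever `‖curl u‖ ≤ Ω` on `[t₁, t₂] × ℝ³` — as an ALL-TIME binder (all
`0 ≤ t₁ < t₂ < T`), although their proofs only ever run it on the geometric slabs `tₙ = T − (T − t₀)q⁻ⁿ ⊂ [t₀, T)`. The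
witness-form deposits cannot be re-instantiated by name on the time-shifted pair `u(· + t₀)` (their signatures demand
`HasRapidSpatialDecay (u t₀)`, generically false for `t₀ > 0`), but the CORE theorems can: the late hypotheses of `u` on
`[t₀, T)` are the all-time hypotheses of the shift on `[0, T − t₀)` (`slab_shift_of_late_slab`, `rate_shift_of_rate`).
This file proves:

* `log_le_of_late_slab` — for a witness of the crux class, `(S_κ)` on the slabs of `[t₀, T)` and the rate
  `(T − t)‖curl u(t, x)‖ ≤ C` on `[t₀, T)` give `log q ≤ 2κC(q − 1)` for every `q > 1` (the geometric slabs
  `integral_sq_norm_curl_geometric_of_slab` run on the SHIFT, against Leray's lower bound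
  `leray_le_integral_sq_norm_curl` for `u` itself — the decay of the datum is used at the ORIGIN only);
* `inv_two_mul_le_of_late_slab` — hence **`1/(2κ) ≤ C`** (`κ > 0`);
* `vorticityRate_witness_const_ge_of_eventually_slab` / `vorticityRate_witness_frequently_gt_of_eventually_slab` /
  `vorticityRateExclusion_below_of_eventually_slab` — the witness forms of deposit 9 with the slab hypothesis weakened to
  an EVENTUAL one, in the crux's own `∀ᶠ t in 𝓝[<] T` idiom: `C ≥ 1/(2κ)`; `limsup_{t→T⁻}(T − t)‖ω(t)‖_∞ ≥ 1/(2κ)`; crux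
  #4's text below the threshold `1/(2κ)`;
* `integral_sq_norm_curl_le_rpow_of_late_slab` — deposit 10's power law `∫|ω(t)|² ≤ ∫|ω(t₀)|²((T − t₀)/(T − t))^{κC}`
  under the late `(S_κ)` (the core theorem on the shift, by name);
* `late_slab_of_late_depletion` — `(D_κ)` on `[t₀, T)` ⇒ `(S_κ)` on the slabs of `[t₀, T)` (`slab_of_depletion` on the
  shift; the Beale–Kato–Majda class of the shift is that of `u`, `hasBoundedSobolevNormsOn_before_of_lerayHopf_classical`),
  and an `example` recovering deposit 13's late depletion floor `inv_two_mul_le_of_late_depletion` through the late slab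
  floor.

READING: every entry of the (K86)/(K93) zone-Z1 dictionary needs its coefficient `κ` only on a left neighbourhood of the
claimed blow-up time; a candidate whose instrument certifies `(S_κ)` (or `(D_κ)`) from some `t₀` on carries the floor
`C_ω ≥ 1/(2κ)`. No new definitions, no named-fact hypotheses, no `sorry`. WHAT THIS IS NOT: not a blow-up or regularity
claim — a priori inequalities about a HYPOTHETICAL witness of the certificate class under hypotheses on its OWN enstrophy
growth; cruxes 8639/8640 and (AX-L) untouched (8640 is proved only below `1/(2κ)` under the late `(S_κ)`).
Author: ns-blowup-profile-eng-1 g15, 2026-08-27.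

## References
* J. C. Robinson, J. L. Rodrigo, W. Sadowski, *The Three-Dimensional Navier–Stokes Equations*, CUP 2016, Thm 12.3
  (12.11)–(12.12). [RobinsonRodrigoSadowski2016]
* J. Leray, Acta Math. 63 (1934), §20 (3.12). [Leray1934]
* J. T. Beale, T. Kato, A. Majda, Comm. Math. Phys. 94 (1984). [BealeKatoMajda1984]
-/

-- the summit and its single problem share the name (D-0017 nested layout)
set_option linter.dupNamespace false

noncomputable section

open MeasureTheory Set Function Filter Topology Metric
open scoped ENNReal NNReal RealInnerProductSpace

namespace Summit.NavierStokesRegularity.NavierStokesRegularity.Theorems.CertifiedBlowupVorticityRateBlowup.LateSlabFloor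

open Literature.Analysis.FluidPDE
open Summit.NavierStokesRegularity.NavierStokesRegularity.Theorems.CertifiedBlowupAxisymBlowup.CompactAmplification
open Summit.NavierStokesRegularity.NavierStokesRegularity.Theorems.CertifiedBlowupVorticityRateBlowup.ConstantFloor
open Summit.NavierStokesRegularity.NavierStokesRegularity.Theorems.CertifiedBlowupVorticityRateBlowup.SlabFloor
open Summit.NavierStokesRegularity.NavierStokesRegularity.Theorems.CertifiedBlowupVorticityRateBlowup.DepletionFloor
open Summit.NavierStokesRegularity.NavierStokesRegularity.Theorems.CertifiedBlowupAxisymBlowup.TimeShift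

variable {ν T : ℝ} {u : ℝ → EuclideanSpace ℝ (Fin 3) → EuclideanSpace ℝ (Fin 3)}
  {p : ℝ → EuclideanSpace ℝ (Fin 3) → ℝ}

/-! ### Dictionary: late hypotheses of `u` are all-time hypotheses of the shift `u(· + t₀)` -/

/-- **`(S_κ)` on the slabs of `[t₀, T)` for `u` is `(S_κ)` on all slabs of `[0, T − t₀)` for the shift `u(· + t₀)`.**
[new here — elementary] -/
theorem slab_shift_of_late_slab {κ t₀ : ℝ}
    (hslab : ∀ ⦃t₁ t₂ Ω : ℝ⦄, t₀ ≤ t₁ → t₁ < t₂ → t₂ < T → (∀ t ∈ Icc t₁ t₂, ∀ x, ‖curl (u t) x‖ ≤ Ω) →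
      ∫ x, ‖curl (u t₂) x‖ ^ 2 ≤ (∫ x, ‖curl (u t₁) x‖ ^ 2) * Real.exp (κ * Ω * (t₂ - t₁))) :
    ∀ ⦃s₁ s₂ Ω : ℝ⦄, 0 ≤ s₁ → s₁ < s₂ → s₂ < T - t₀ →
      (∀ s ∈ Icc s₁ s₂, ∀ x, ‖curl ((fun s => u (s + t₀)) s) x‖ ≤ Ω) →
      ∫ x, ‖curl ((fun s => u (s + t₀)) s₂) x‖ ^ 2 ≤
        (∫ x, ‖curl ((fun s => u (s + t₀)) s₁) x‖ ^ 2) * Real.exp (κ * Ω * (s₂ - s₁)) := by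
  intro s₁ s₂ Ω hs₁ h12 hs₂ hΩ
  have h := hslab (t₁ := s₁ + t₀) (t₂ := s₂ + t₀) (Ω := Ω) (by linarith) (by linarith) (by linarith)
    (fun t ht x => by
      have := hΩ (t - t₀) ⟨by linarith [ht.1], by linarith [ht.2]⟩ x
      simpa only [sub_add_cancel] using this)
  simpa only [add_sub_add_right_eq_sub] using h

/-- **The rate on `[t₀, T)` for `u` is the rate on `[0, T − t₀)` for the shift `u(· + t₀)`** (same constant, same
`T − t`). [new here — elementary] -/
theorem rate_shift_of_rate {C t₀ : ℝ} (hω : ∀ t ∈ Ico t₀ T, ∀ x, (T - t) * ‖curl (u t) x‖ ≤ C) :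
    ∀ s ∈ Ico 0 (T - t₀), ∀ x, (T - t₀ - s) * ‖curl ((fun s => u (s + t₀)) s) x‖ ≤ C := by
  intro s hs x
  have h := hω (s + t₀) ⟨by linarith [hs.1], by linarith [hs.2]⟩ x
  have e : T - (s + t₀) = T - t₀ - s := by ring
  rwa [e] at h

/-! ### The floor under the late slab Grönwall -/

/-- **`log q ≤ 2κC(q − 1)` under the LATE slab Grönwall.** For a witness `(ν, T, u, p)` of the crux class and
`0 ≤ t₀ < T`: if `(S_κ)` holds on the slabs of `[t₀, T)` and `(T − t)‖curl u(t, x)‖ ≤ C` on `[t₀, T) × ℝ³`, then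
`log q ≤ 2κC(q − 1)` for every `q > 1`. Along `tₙ = T − (T − t₀)q⁻ⁿ`: the geometric Grönwall
`∫|ω(tₙ)|² ≤ ∫|ω(t₀)|²·exp(κC(q − 1))ⁿ` is the tree's `integral_sq_norm_curl_geometric_of_slab` for the SHIFT from time
`0`, Leray's `cν^{3/2}√qⁿ/√(T − t₀) ≤ ∫|ω(tₙ)|²` is `leray_le_integral_sq_norm_curl` for `u`; `(√q/exp(κC(q−1)))ⁿ` bounded
forces `√q ≤ exp(κC(q − 1))` (the tree's `log_le_of_slab`, verbatim from there on).
[cite: RobinsonRodrigoSadowski2016, Thm 12.3 (12.11)–(12.12); Leray1934, §20 (3.12)] -/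
theorem log_le_of_late_slab (hν : 0 < ν) (hT : 0 < T) (hmax : IsMaximalSmoothSolution ν 0 u p T)
    (hLH : IsLerayHopfOn T ν 0 (u 0) u) (hdec : HasRapidSpatialDecay (u 0)) (haxi : IsAxisymmetric (u 0))
    {κ t₀ : ℝ} (ht₀ : 0 ≤ t₀) (ht₀T : t₀ < T)
    (hslab : ∀ ⦃t₁ t₂ Ω : ℝ⦄, t₀ ≤ t₁ → t₁ < t₂ → t₂ < T → (∀ t ∈ Icc t₁ t₂, ∀ x, ‖curl (u t) x‖ ≤ Ω) →
      ∫ x, ‖curl (u t₂) x‖ ^ 2 ≤ (∫ x, ‖curl (u t₁) x‖ ^ 2) * Real.exp (κ * Ω * (t₂ - t₁)))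
    {C : ℝ} (hω : ∀ t ∈ Ico t₀ T, ∀ x, (T - t) * ‖curl (u t) x‖ ≤ C) {q : ℝ} (hq : 1 < q) :
    Real.log q ≤ 2 * κ * C * (q - 1) := by
  -- adapted from the tree's `log_le_of_slab`, with the geometric slabs run on the shifted field
  obtain ⟨c, hc, hler⟩ := leray_le_integral_sq_norm_curl
  have ha0 : 0 < T - t₀ := sub_pos.2 ht₀T
  have hq0 : 0 < q := by linarith
  -- the geometric Grönwall for the shift from time `0`, read back on `u` from time `t₀`
  have hgeom : ∀ n : ℕ, ∫ x, ‖curl (u (T - (T - t₀) / q ^ n)) x‖ ^ 2 ≤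
      (∫ x, ‖curl (u t₀) x‖ ^ 2) * Real.exp (κ * C * (q - 1)) ^ n := by
    intro n
    have h2 := integral_sq_norm_curl_geometric_of_slab (u := fun s => u (s + t₀)) (slab_shift_of_late_slab hslab)
      le_rfl ha0 (rate_shift_of_rate hω) hq n
    have e2 : T - t₀ - (T - t₀ - 0) / q ^ n + t₀ = T - (T - t₀) / q ^ n := by ring
    simpa only [e2, zero_add] using h2
  set a : ℝ := T - t₀ with ha
  set E₀ : ℝ := ∫ x, ‖curl (u t₀) x‖ ^ 2 with hE₀
  set r : ℝ := Real.exp (κ * C * (q - 1)) with hr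
  have hr0 : 0 < r := Real.exp_pos _
  set L : ℝ := c * ν ^ (3 / 2 : ℝ) / Real.sqrt a with hL
  have hL0 : 0 < L := div_pos (mul_pos hc (Real.rpow_pos_of_pos hν _)) (Real.sqrt_pos.2 ha0)
  have hbound : ∀ n : ℕ, L * Real.sqrt q ^ n ≤ E₀ * r ^ n := by
    intro n
    have hqn : 0 < q ^ n := pow_pos hq0 n
    have htn : T - a / q ^ n ∈ Ico 0 T := by
      refine ⟨?_, by linarith [div_pos ha0 hqn]⟩
      have : a / q ^ n ≤ a := div_le_self ha0.le (one_le_pow₀ hq.le)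
      linarith
    have h1 := hler hν hT hmax hLH hdec haxi _ htn
    have h2 := hgeom n
    have hsq : Real.sqrt (T - (T - a / q ^ n)) = Real.sqrt a / Real.sqrt q ^ n := by
      rw [sub_sub_cancel, Real.sqrt_div' a (le_of_lt hqn)]
      congr 1
      rw [show q ^ n = (Real.sqrt q ^ n) ^ 2 by rw [← pow_mul, mul_comm, pow_mul, Real.sq_sqrt hq0.le],
        Real.sqrt_sq (pow_nonneg (Real.sqrt_nonneg _) _)]
    have hLq : c * ν ^ (3 / 2 : ℝ) / Real.sqrt (T - (T - a / q ^ n)) = L * Real.sqrt q ^ n := by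
      rw [hsq, hL]
      field_simp
    rw [hLq] at h1
    exact h1.trans h2
  have hsr : Real.sqrt q ≤ r := by
    by_contra hlt
    push Not at hlt
    have hgt : 1 < Real.sqrt q / r := (one_lt_div hr0).2 hlt
    have htop : Tendsto (fun n : ℕ => (Real.sqrt q / r) ^ n) atTop atTop := tendsto_pow_atTop_atTop_of_one_lt hgt
    obtain ⟨n, hn⟩ := (htop.eventually_gt_atTop (E₀ / L)).exists
    have h := hbound n
    have : (Real.sqrt q / r) ^ n ≤ E₀ / L := by
      rw [div_pow, div_le_div_iff₀ (pow_pos hr0 n) hL0]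
      calc Real.sqrt q ^ n * L = L * Real.sqrt q ^ n := mul_comm _ _
        _ ≤ E₀ * r ^ n := h
    linarith
  have hlog := Real.log_le_log (Real.sqrt_pos.2 hq0) hsr
  rw [Real.log_sqrt hq0.le, hr, Real.log_exp] at hlog
  linarith

/-- **THE FLOOR UNDER THE LATE SLAB GRÖNWALL: `1/(2κ) ≤ C`** (`κ > 0`; `(S_κ)` on the slabs of `[t₀, T)` and the rate on
`[t₀, T)` only). From `log q ≤ 2κC(q − 1)` and `1 − 1/q ≤ log q`: `1/q ≤ 2κC` for every `q > 1` (the tree's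
`inv_two_mul_le_of_slab`, verbatim after `log_le_of_late_slab`). [cite: RobinsonRodrigoSadowski2016, Thm 12.3 (12.11)–(12.12); Leray1934, §20 (3.12)] -/
theorem inv_two_mul_le_of_late_slab (hν : 0 < ν) (hT : 0 < T) (hmax : IsMaximalSmoothSolution ν 0 u p T)
    (hLH : IsLerayHopfOn T ν 0 (u 0) u) (hdec : HasRapidSpatialDecay (u 0)) (haxi : IsAxisymmetric (u 0))
    {κ : ℝ} (hκ : 0 < κ) {t₀ : ℝ} (ht₀ : 0 ≤ t₀) (ht₀T : t₀ < T)
    (hslab : ∀ ⦃t₁ t₂ Ω : ℝ⦄, t₀ ≤ t₁ → t₁ < t₂ → t₂ < T → (∀ t ∈ Icc t₁ t₂, ∀ x, ‖curl (u t) x‖ ≤ Ω) →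
      ∫ x, ‖curl (u t₂) x‖ ^ 2 ≤ (∫ x, ‖curl (u t₁) x‖ ^ 2) * Real.exp (κ * Ω * (t₂ - t₁)))
    {C : ℝ} (hω : ∀ t ∈ Ico t₀ T, ∀ x, (T - t) * ‖curl (u t) x‖ ≤ C) :
    1 / (2 * κ) ≤ C := by
  -- adapted from the tree's `inv_two_mul_le_of_slab`
  set A : ℝ := 2 * κ * C with hA
  have hmain : ∀ q : ℝ, 1 < q → 1 / q ≤ A := by
    intro q hq
    have hq0 : 0 < q := by linarith
    have h1 := log_le_of_late_slab hν hT hmax hLH hdec haxi ht₀ ht₀T hslab hω hq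
    have h2 : 1 - q⁻¹ ≤ Real.log q := Real.one_sub_inv_le_log_of_pos hq0
    have h3 : 1 - q⁻¹ = (q - 1) / q := by field_simp
    have hq1 : 0 < q - 1 := by linarith
    have h4 : (q - 1) / q ≤ A * (q - 1) := by rw [hA]; linarith [h3 ▸ h2]
    rw [div_le_iff₀ hq0] at h4
    rw [div_le_iff₀ hq0]
    nlinarith
  have hA1 : 1 ≤ A := by
    by_contra hlt
    push Not at hlt
    have hA0 : 0 < A := by
      have h := hmain 2 (by norm_num)
      linarith
    have hq : 1 < (1 + A) / (2 * A) := by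
      rw [lt_div_iff₀ (by positivity)]; linarith
    have h := hmain _ hq
    rw [one_div_div, div_le_iff₀ (by positivity)] at h
    nlinarith
  rw [div_le_iff₀ (by positivity)]
  linarith

/-! ### Witness forms, both hypotheses eventual -/

/-- **WITNESSES WITH `(S_κ)` EVENTUALLY HAVE `C ≥ 1/(2κ)`.** For every witness `(ν, T, u, p)` of the certificate class and
`κ > 0`: if EVENTUALLY as `t₁ → T⁻` every slab `[t₁, t₂]`, `t₂ < T`, obeys `(S_κ)`, and EVENTUALLY
`(T − t)‖curl u(t, x)‖ ≤ C` for all `x`, then `1/(2κ) ≤ C` — deposit 9's `vorticityRate_witness_const_ge_of_slab` with its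
all-time slab hypothesis weakened to an eventual one. [cite: RobinsonRodrigoSadowski2016, Thm 12.3 (12.11)–(12.12); Leray1934, §20 (3.12)] -/
theorem vorticityRate_witness_const_ge_of_eventually_slab (hν : 0 < ν) (hT : 0 < T)
    (hmax : IsMaximalSmoothSolution ν 0 u p T) (hLH : IsLerayHopfOn T ν 0 (u 0) u)
    (hdec : HasRapidSpatialDecay (u 0)) (haxi : IsAxisymmetric (u 0)) {κ : ℝ} (hκ : 0 < κ)
    (hslab : ∀ᶠ t₁ in 𝓝[<] T, ∀ ⦃t₂ Ω : ℝ⦄, t₁ < t₂ → t₂ < T → (∀ t ∈ Icc t₁ t₂, ∀ x, ‖curl (u t) x‖ ≤ Ω) →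
      ∫ x, ‖curl (u t₂) x‖ ^ 2 ≤ (∫ x, ‖curl (u t₁) x‖ ^ 2) * Real.exp (κ * Ω * (t₂ - t₁)))
    {C : ℝ} (hrate : ∀ᶠ t in 𝓝[<] T, ∀ x : EuclideanSpace ℝ (Fin 3), (T - t) * ‖curl (u t) x‖ ≤ C) :
    1 / (2 * κ) ≤ C := by
  obtain ⟨l, hlT, hl⟩ := mem_nhdsLT_iff_exists_Ioo_subset.1 (hslab.and hrate)
  have hlT' : l < T := hlT
  set t₀ : ℝ := max 0 ((l + T) / 2) with ht₀
  have ht₀0 : 0 ≤ t₀ := le_max_left _ _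
  have ht₀T : t₀ < T := max_lt hT (by linarith)
  have hlt₀ : l < t₀ := lt_of_lt_of_le (by linarith) (le_max_right _ _)
  have hω : ∀ t ∈ Ico t₀ T, ∀ x, (T - t) * ‖curl (u t) x‖ ≤ C := fun t ht =>
    (hl ⟨lt_of_lt_of_le hlt₀ ht.1, ht.2⟩).2
  have hslab' : ∀ ⦃t₁ t₂ Ω : ℝ⦄, t₀ ≤ t₁ → t₁ < t₂ → t₂ < T →
      (∀ t ∈ Icc t₁ t₂, ∀ x, ‖curl (u t) x‖ ≤ Ω) →
      ∫ x, ‖curl (u t₂) x‖ ^ 2 ≤ (∫ x, ‖curl (u t₁) x‖ ^ 2) * Real.exp (κ * Ω * (t₂ - t₁)) :=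
    fun t₁ t₂ Ω ht₁ h12 ht₂ hΩ => (hl ⟨lt_of_lt_of_le hlt₀ ht₁, h12.trans ht₂⟩).1 h12 ht₂ hΩ
  exact inv_two_mul_le_of_late_slab hν hT hmax hLH hdec haxi hκ ht₀0 ht₀T hslab' hω

/-- **Equivalently: `limsup_{t → T⁻} (T − t)‖curl u(t)‖_∞ ≥ 1/(2κ)` under the eventual `(S_κ)`** — for every
`C' < 1/(2κ)`, frequently as `t → T⁻` some point has `C' < (T − t)‖curl u(t, x)‖`.
[cite: RobinsonRodrigoSadowski2016, Thm 12.3 (12.11)–(12.12); Leray1934, §20 (3.12)] -/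
theorem vorticityRate_witness_frequently_gt_of_eventually_slab (hν : 0 < ν) (hT : 0 < T)
    (hmax : IsMaximalSmoothSolution ν 0 u p T) (hLH : IsLerayHopfOn T ν 0 (u 0) u)
    (hdec : HasRapidSpatialDecay (u 0)) (haxi : IsAxisymmetric (u 0)) {κ : ℝ} (hκ : 0 < κ)
    (hslab : ∀ᶠ t₁ in 𝓝[<] T, ∀ ⦃t₂ Ω : ℝ⦄, t₁ < t₂ → t₂ < T → (∀ t ∈ Icc t₁ t₂, ∀ x, ‖curl (u t) x‖ ≤ Ω) →
      ∫ x, ‖curl (u t₂) x‖ ^ 2 ≤ (∫ x, ‖curl (u t₁) x‖ ^ 2) * Real.exp (κ * Ω * (t₂ - t₁)))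
    {C' : ℝ} (hC' : C' < 1 / (2 * κ)) :
    ∃ᶠ t in 𝓝[<] T, ∃ x : EuclideanSpace ℝ (Fin 3), C' < (T - t) * ‖curl (u t) x‖ := by
  by_contra h
  rw [Filter.not_frequently] at h
  have h' : ∀ᶠ t in 𝓝[<] T, ∀ x : EuclideanSpace ℝ (Fin 3), (T - t) * ‖curl (u t) x‖ ≤ C' :=
    h.mono fun t ht x => not_lt.1 fun hx => ht ⟨x, hx⟩
  exact (not_le.2 hC') (vorticityRate_witness_const_ge_of_eventually_slab hν hT hmax hLH hdec haxi hκ hslab h')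

/-- **THE KILL STATEMENT BELOW `1/(2κ)` UNDER THE EVENTUAL `(S_κ)`.** The text of crux #4
`CertifiedBlowupVorticityRateExclusion` with the EVENTUAL slab hypothesis added and `∀ C` restricted to `∀ C < 1/(2κ)`
(verbatim otherwise) — deposit 9's `vorticityRateExclusion_below_of_slab` with `(S_κ)` needed only near `T`.
[cite: RobinsonRodrigoSadowski2016, Thm 12.3 (12.11)–(12.12); Leray1934, §20 (3.12)] -/
theorem vorticityRateExclusion_below_of_eventually_slab {κ : ℝ} (hκ : 0 < κ) : ∀ ν : ℝ, 0 < ν → ∀ T : ℝ, 0 < T →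
    ∀ (u : ℝ → EuclideanSpace ℝ (Fin 3) → EuclideanSpace ℝ (Fin 3)) (p : ℝ → EuclideanSpace ℝ (Fin 3) → ℝ),
    IsMaximalSmoothSolution ν 0 u p T → IsLerayHopfOn T ν 0 (u 0) u → HasRapidSpatialDecay (u 0) →
    IsAxisymmetric (u 0) →
    (∀ᶠ t₁ in 𝓝[<] T, ∀ ⦃t₂ Ω : ℝ⦄, t₁ < t₂ → t₂ < T → (∀ t ∈ Icc t₁ t₂, ∀ x, ‖curl (u t) x‖ ≤ Ω) →
      ∫ x, ‖curl (u t₂) x‖ ^ 2 ≤ (∫ x, ‖curl (u t₁) x‖ ^ 2) * Real.exp (κ * Ω * (t₂ - t₁))) →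
    ∀ C : ℝ, C < 1 / (2 * κ) →
    ∃ᶠ t in 𝓝[<] T, ∃ x : EuclideanSpace ℝ (Fin 3), C < (T - t) * ‖curl (u t) x‖ :=
  fun _ hν _ hT _ _ hmax hLH hdec haxi hslab _ hC =>
    vorticityRate_witness_frequently_gt_of_eventually_slab hν hT hmax hLH hdec haxi hκ hslab hC

/-! ### Deposit 10's power law under the late `(S_κ)` -/

/-- **The power law under the LATE slab Grönwall**: `(S_κ)` on the slabs of `[t₀, T)` and the rate on `[t₀, T)`
(`0 ≤ t₀ < T`) give `∫|curl u(t)|² ≤ (∫|curl u(t₀)|²)·((T − t₀)/(T − t))^{κC}` for every `t ∈ [t₀, T)` — deposit 10's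
`integral_sq_norm_curl_le_rpow_of_slab` BY NAME on the shift `u(· + t₀)` at time `t − t₀`.
[cite: RobinsonRodrigoSadowski2016, Thm 12.3 (12.12)] -/
theorem integral_sq_norm_curl_le_rpow_of_late_slab {κ t₀ : ℝ} (ht₀T : t₀ < T)
    (hslab : ∀ ⦃t₁ t₂ Ω : ℝ⦄, t₀ ≤ t₁ → t₁ < t₂ → t₂ < T → (∀ t ∈ Icc t₁ t₂, ∀ x, ‖curl (u t) x‖ ≤ Ω) →
      ∫ x, ‖curl (u t₂) x‖ ^ 2 ≤ (∫ x, ‖curl (u t₁) x‖ ^ 2) * Real.exp (κ * Ω * (t₂ - t₁)))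
    {C : ℝ} (hω : ∀ t ∈ Ico t₀ T, ∀ x, (T - t) * ‖curl (u t) x‖ ≤ C) {t : ℝ} (ht : t ∈ Ico t₀ T) :
    ∫ x, ‖curl (u t) x‖ ^ 2 ≤ (∫ x, ‖curl (u t₀) x‖ ^ 2) * ((T - t₀) / (T - t)) ^ (κ * C) := by
  have h := integral_sq_norm_curl_le_rpow_of_slab (u := fun s => u (s + t₀)) (slab_shift_of_late_slab hslab)
    le_rfl (sub_pos.2 ht₀T) (rate_shift_of_rate hω) (t := t - t₀) ⟨sub_nonneg.2 ht.1, by linarith [ht.2]⟩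
  have e1 : T - t₀ - (t - t₀) = T - t := by ring
  simpa only [sub_add_cancel, zero_add, sub_zero, e1] using h

/-! ### `(D_κ)` late ⇒ `(S_κ)` late, and deposit 13's late floor recovered -/

/-- **`(D_κ)` on `[t₀, T)` implies `(S_κ)` on the slabs of `[t₀, T)`** (`κ ≥ 0`; classical solution on `[0, T)` in the
Beale–Kato–Majda class on earlier slabs): the tree's all-time `slab_of_depletion` applied to the SHIFT `u(· + t₀)` — a
classical solution on `[0, T − t₀)` (`IsClassicalNSSolutionOn.translate_Ico_zero`) whose Beale–Kato–Majda class on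
`[0, T″]`, `T″ < T − t₀`, is that of `u` on `[0, T″ + t₀]`, `TimeShift.hasBoundedSobolevNormsOn_shift` — and read back on `u`.
[new here — elementary] -/
theorem late_slab_of_late_depletion (hν : 0 < ν) (hcl : IsClassicalNSSolutionOn (Ico 0 T) ν 0 u p)
    (hreg : ∀ T'' < T, HasBoundedSobolevNormsOn (Icc 0 T'') u) {κ : ℝ} (hκ : 0 ≤ κ) {t₀ : ℝ} (ht₀ : 0 ≤ t₀)
    (hdep : ∀ t ∈ Ico t₀ T, ∀ Ω : ℝ, (∀ x, ‖curl (u t) x‖ ≤ Ω) →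
      2 * ∫ x, ⟪curl (u t) x, fderiv ℝ (u t) x (curl (u t) x)⟫ ≤ κ * Ω * ∫ x, ‖curl (u t) x‖ ^ 2) :
    ∀ ⦃t₁ t₂ Ω : ℝ⦄, t₀ ≤ t₁ → t₁ < t₂ → t₂ < T → (∀ t ∈ Icc t₁ t₂, ∀ x, ‖curl (u t) x‖ ≤ Ω) →
      ∫ x, ‖curl (u t₂) x‖ ^ 2 ≤ (∫ x, ‖curl (u t₁) x‖ ^ 2) * Real.exp (κ * Ω * (t₂ - t₁)) := by
  intro t₁ t₂ Ω ht₁ h12 ht₂ hΩ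
  set v : ℝ → EuclideanSpace ℝ (Fin 3) → EuclideanSpace ℝ (Fin 3) := fun s => u (s + t₀) with hv
  have hcl_v : IsClassicalNSSolutionOn (Ico 0 (T - t₀)) ν 0 v (fun s => p (s + t₀)) :=
    hcl.translate_Ico_zero ht₀
  have hreg_v : ∀ T'' < T - t₀, HasBoundedSobolevNormsOn (Icc 0 T'') v := hasBoundedSobolevNormsOn_shift hreg ht₀
  have hdep_v : ∀ s ∈ Ico 0 (T - t₀), ∀ Ω : ℝ, (∀ x, ‖curl (v s) x‖ ≤ Ω) →
      2 * ∫ x, ⟪curl (v s) x, fderiv ℝ (v s) x (curl (v s) x)⟫ ≤ κ * Ω * ∫ x, ‖curl (v s) x‖ ^ 2 :=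
    fun s hs => hdep (s + t₀) ⟨by linarith [hs.1], by linarith [hs.2]⟩
  have h := slab_of_depletion hν hcl_v hreg_v hκ hdep_v (t₁ := t₁ - t₀) (t₂ := t₂ - t₀) (Ω := Ω)
    (by linarith) (by linarith) (by linarith)
    (fun s hs x => by
      have := hΩ (s + t₀) ⟨by linarith [hs.1], by linarith [hs.2]⟩ x
      simpa only [hv] using this)
  simpa only [hv, sub_add_cancel, sub_sub_sub_cancel_right] using h

/-- The late slab floor recovers deposit 13's late depletion floor `inv_two_mul_le_of_late_depletion` (p572664): `(D_κ)`
on `[t₀, T)` ⇒ `(S_κ)` on the slabs of `[t₀, T)` (`late_slab_of_late_depletion`, `hreg` from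
`hasBoundedSobolevNormsOn_before_of_lerayHopf_classical`) ⇒ `1/(2κ) ≤ C`.
[cite: RobinsonRodrigoSadowski2016, Thm 12.3 (12.11)–(12.12); Leray1934, §20 (3.12)] -/
example (hν : 0 < ν) (hT : 0 < T) (hmax : IsMaximalSmoothSolution ν 0 u p T)
    (hLH : IsLerayHopfOn T ν 0 (u 0) u) (hdec : HasRapidSpatialDecay (u 0)) (haxi : IsAxisymmetric (u 0))
    {κ : ℝ} (hκ : 0 < κ) {C t₀ : ℝ} (ht₀ : 0 ≤ t₀) (ht₀T : t₀ < T)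
    (hdep : ∀ t ∈ Ico t₀ T, ∀ Ω : ℝ, (∀ x, ‖curl (u t) x‖ ≤ Ω) →
      2 * ∫ x, ⟪curl (u t) x, fderiv ℝ (u t) x (curl (u t) x)⟫ ≤ κ * Ω * ∫ x, ‖curl (u t) x‖ ^ 2)
    (hω : ∀ t ∈ Ico t₀ T, ∀ x, (T - t) * ‖curl (u t) x‖ ≤ C) : 1 / (2 * κ) ≤ C :=
  inv_two_mul_le_of_late_slab hν hT hmax hLH hdec haxi hκ ht₀ ht₀T
    (late_slab_of_late_depletion hν hmax.1
      (hasBoundedSobolevNormsOn_before_of_lerayHopf_classical hν hT hmax.1 hLH hdec) hκ.le ht₀ hdep) hω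

/-- Conversely to nothing: the late floor with `t₀ = 0` IS deposit 9's all-time floor `inv_two_mul_le_of_slab` (same
18 binders, `t₀ ≤ t₁` read as `0 ≤ t₁`). [cite: RobinsonRodrigoSadowski2016, Thm 12.3 (12.11)–(12.12)] -/
example (hν : 0 < ν) (hT : 0 < T) (hmax : IsMaximalSmoothSolution ν 0 u p T)
    (hLH : IsLerayHopfOn T ν 0 (u 0) u) (hdec : HasRapidSpatialDecay (u 0)) (haxi : IsAxisymmetric (u 0))
    {κ : ℝ} (hκ : 0 < κ)
    (hslab : ∀ ⦃t₁ t₂ Ω : ℝ⦄, 0 ≤ t₁ → t₁ < t₂ → t₂ < T → (∀ t ∈ Icc t₁ t₂, ∀ x, ‖curl (u t) x‖ ≤ Ω) →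
      ∫ x, ‖curl (u t₂) x‖ ^ 2 ≤ (∫ x, ‖curl (u t₁) x‖ ^ 2) * Real.exp (κ * Ω * (t₂ - t₁)))
    {C t₀ : ℝ} (ht₀ : 0 ≤ t₀) (ht₀T : t₀ < T) (hω : ∀ t ∈ Ico t₀ T, ∀ x, (T - t) * ‖curl (u t) x‖ ≤ C) :
    1 / (2 * κ) ≤ C :=
  inv_two_mul_le_of_late_slab hν hT hmax hLH hdec haxi hκ ht₀ ht₀T
    (fun _ _ _ ht₁ h12 ht₂ hΩ => hslab (ht₀.trans ht₁) h12 ht₂ hΩ) hω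

end Summit.NavierStokesRegularity.NavierStokesRegularity.Theorems.CertifiedBlowupVorticityRateBlowup.LateSlabFloor

end
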